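import Mathlib.RingTheory.Ideal.Pointwise
import Literature.NumberTheory.GaloisRepresentations.ContinuousCorestrictionRelConj
import Literature.NumberTheory.GaloisRepresentations.AbsIntegersEquiv
import HarnessLib

/-!
# Euler systems are stable under the action of `Γ_K`; unramified and locally trivial classes
# are `Γ_K`-stable

Generic continuous Galois cohomology and Euler-system theory (no elliptic curves, no `sorry`, no
definition, no named fact).  Let `K` be a number field, `T` a `p`-adic representation of `Γ_K`
(`GaloisRep K A T`), `L` a system of Euler-system levels (`EulerSystemLevels K ι`: open subgroups
`Gal(K̄/F_i(r)) ≤ Γ_K` with ABELIAN quotients) and `c = (c_{i,r})` an Euler system for `(T, L, p)`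
in the sense of Rubin (tree `IsEulerSystem`: corestriction relations with the Euler factors
`P(Fr_q⁻¹ | T*; Fr_q⁻¹)`).  For `τ ∈ Γ_K` the classes `τ · c_{i,r}` (the action `conjMap` of `Γ_K` on
`H¹(F_i(r), T)`, Serre *Local Fields* VII §5) again form an Euler system (`IsEulerSystem.conj`): this is
the statement that the Euler systems of `T` form a module over the group ring `A[Γ_K]` (Rubin, PCMI
lectures §4.1: "the `ℤ_p[[G_ℚ]]`-module of Euler systems"; Mazur–Rubin; used e.g. for the twisting
and the "universal Euler system" arguments).  Ingredients: corestriction is `Γ_K`-equivariant (tree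
`coresLe_conjMap`, NSW Prop. 1.5.4) and, the levels being abelian over `K`, the operator of `τ` commutes
with `Fr_q⁻¹` and hence with the Euler factor (`commute_conjMap_of_commutator_le`,
`conjMap_eulerFactorOp_apply`).

We also record that the two standard LOCAL conditions on a class `y ∈ H¹(U, X)` (`U ⊴ Γ_K` open,
`X` any topological `Γ_K`-module) are `Γ_K`-stable, because `τ⁻¹ I_𝔓 τ = I_{τ⁻¹𝔓}`,
`τ⁻¹ D_𝔓 τ = D_{τ⁻¹𝔓}` and `τ⁻¹𝔓` again lies over the same place `v`:
* unramified at `v`: `res_{U ∩ I_𝔓} y = 0` for all primes `𝔓 ∣ v` of `\bar ℤ_K`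
  (`forall_resLe_inf_inertia_conjMap_eq_zero`);
* locally trivial at `v`: `res_{U ∩ D_𝔓} y = 0` for all `𝔓 ∣ v`
  (`forall_resLe_inf_stabilizer_conjMap_eq_zero`);
both from the cocycle identity `(τ·φ)|_I = ∂(τ w)` when `φ|_{τ⁻¹Iτ} = ∂w`
(`resLe_conjMap_eq_zero_of_forall_conj_mem`, re-homed from the `b2b-bsdres` cell's
`Summits/…/GaloisImage/KolyvaginDerivativeUnramifiedClass.lean`, `Derivative.resLe_conjMap_eq_zero`,
which Literature cannot import).

Consumer: `Summits/BirchSwinnertonDyer/…/Theorems/KatoDescentPotSupersingularZetaBodyRefit*.lean`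
(the group-ring refits of Kato's zeta data; these lemmas discharge the transport hypotheses
`hES`/`hur`/`hloc` displayed there).

## References
* K. Rubin, *Euler Systems*, Annals of Math. Studies 147 (2000), Def. 2.1.1, Ch. IV §4. [Rubin2000]
* K. Rubin, *Euler systems and Kolyvagin systems* (PCMI 18, 2011), §4.1. [Rubin2011]
* J. Neukirch, A. Schmidt, K. Wingberg, *Cohomology of Number Fields* (2008), I §5 Prop. 1.5.4
  (compatibility of `cor`, `res` with conjugation). [NeukirchSchmidtWingberg2008]
* J.-P. Serre, *Local Fields* (1979), VII §5 (the action of `G/H` on `H^q(H, A)`), I §7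
  (conjugate primes, decomposition and inertia groups). [SerreLocalFields1979]

## Design notes
* No definition is introduced; the conjugated family is written `fun i r ↦ conjMap … τ 1 (c i r)`.
* The commutation of `τ` with the Euler factor uses only `[Γ_K, Γ_K] ≤ U` (every level of an
  `EulerSystemLevels` is abelian over `K`, `EulerSystemLevels.commutator_le_level`); no hypothesis on
  `T` or on the Frobenius element is needed.
-/

noncomputable section

open CategoryTheory Polynomial
open scoped Pointwise NumberField Classical

universe u v w

namespace Literature.NumberTheory.GaloisRepresentations

open Field IsDedekindDomain
open Literature.NumberTheory.EllipticCurves (subgroupInclusion subgroupConj subgroupConj_apply_coe)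

/-! ## §1 Generic continuous cohomology: `res ∘ conj`, commuting operators -/

section Generic

variable {R : Type v} [Ring R] [TopologicalSpace R]
variable {G : Type u} [Group G] [TopologicalSpace G] [IsTopologicalGroup G]
variable (X : TopRep.{u} R G) (H : Subgroup G) [H.Normal]

/-- **`res_I (g · y) = 0` when `res_{I'} y = 0` and `g⁻¹ I g ⊆ I'`** (`I, I' ≤ H ⊴ G`): if
`φ|_{I'} = ∂w` then `(g·φ)|_I = ∂(g w)`, since `(g·φ)(s) = g φ(g⁻¹ s g) = g((g⁻¹sg) w − w) = s (g w) − g w`.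
Re-homed from `Summits/BirchSwinnertonDyer/Rank1Residual/GaloisImage/KolyvaginDerivativeUnramifiedClass.lean`
(`Derivative.resLe_conjMap_eq_zero`, cell `b2b-bsdres`), which Literature cannot import.
[cite: SerreLocalFields1979, VII §5] -/
theorem resLe_conjMap_eq_zero_of_forall_conj_mem (g : G) {I I' : Subgroup G} (hIH : I ≤ H)
    (hI'H : I' ≤ H) (hI' : ∀ s ∈ I, g⁻¹ * s * g ∈ I')
    {y : continuousCohomology 1 (subgroupRep X H)} (hy : resLe X hI'H 1 y = 0) :
    resLe X hIH 1 (conjMap X H g 1 y) = 0 := by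
  obtain ⟨φ, rfl⟩ := oneCocycleClass_surjective _ y
  rw [resLe_oneCocycleClass, oneCocycleClass_eq_zero_iff] at hy
  obtain ⟨w, hw⟩ := hy
  rw [conjMap_oneCocycleClass, resLe_oneCocycleClass, oneCocycleClass_eq_zero_iff]
  refine ⟨X.ρ g w, fun s ↦ ?_⟩
  have hws : φ.1 ⟨g⁻¹ * (s : G) * g, hI'H (hI' s s.2)⟩ = X.ρ (g⁻¹ * (s : G) * g) w - w :=
    hw ⟨g⁻¹ * (s : G) * g, hI' s s.2⟩
  change X.ρ g (φ.1 ⟨g⁻¹ * (s : G) * g, _⟩) = X.ρ (s : G) (X.ρ g w) - X.ρ g w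
  rw [hws, map_sub, ← ρ_mul_apply, ← ρ_mul_apply, show g * (g⁻¹ * (s : G) * g) = (s : G) * g by group]

open scoped commutatorElement in
/-- **The operators of `a, b ∈ G` on `H¹(H, X)` commute when `G ⧸ H` is abelian** (`[G, G] ≤ H`):
`a·(b·y) = (ab)·y = (ba)·y = b·(a·y)` as `(ba)⁻¹(ab) = [a⁻¹, b⁻¹] ∈ H` acts trivially.
[cite: SerreLocalFields1979, VII §5 Prop. 3] -/
theorem commute_conjMap_of_commutator_le (hH : commutator G ≤ H) (a b : G) :
    Commute (conjMap X H a 1).hom.toLinearMap (conjMap X H b 1).hom.toLinearMap := by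
  refine LinearMap.ext fun y ↦ ?_
  change conjMap X H a 1 (conjMap X H b 1 y) = conjMap X H b 1 (conjMap X H a 1 y)
  rw [← conjMap_mul_apply_one, ← conjMap_mul_apply_one]
  refine conjMap_apply_one_eq_of_inv_mul_mem X H (hH ?_) y
  have e : (b * a)⁻¹ * (a * b) = ⁅a⁻¹, b⁻¹⁆ := by
    rw [commutatorElement_def]
    group
  rw [e, commutator_def]
  exact Subgroup.commutator_mem_commutator (Subgroup.mem_top _) (Subgroup.mem_top _)

end Generic

/-- **An element commuting with `x` commutes with every polynomial in `x`** (private algebra helper).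
[folklore] -/
private theorem aeval_left_of_commute {S B : Type*} [CommSemiring S] [Semiring B] [Algebra S B]
    {x y : B} (h : Commute x y) (P : S[X]) : Commute (aeval x P) y := by
  induction P using Polynomial.induction_on' with
  | add p q hp hq =>
    rw [map_add]
    exact hp.add_left hq
  | monomial n a =>
    rw [aeval_monomial]
    exact (Algebra.commute_algebraMap_left a y).mul_left (h.pow_left n)

/-! ## §2 The Euler factor commutes with the `Γ_K`-action on an abelian level -/

section EulerFactor

variable {K : Type u} [Field K]
variable {A : Type v} [CommRing A] [TopologicalSpace A]
variable {M : Type u} [AddCommGroup M] [Module A M] [TopologicalSpace M] [IsTopologicalAddGroup M]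
  [ContinuousSMul A M] [Module.Free A M] [Module.Finite A M]
variable (T : GaloisRep K A M) (p : ℕ) [Fact p.Prime] [Algebra ℤ_[p] A]

/-- **`τ · (P(Fr_q⁻¹ | T*; Fr_q⁻¹) y) = P(Fr_q⁻¹ | T*; Fr_q⁻¹) (τ · y)`** on `H¹(U, T)` for `U ⊴ Γ_K`
with `Γ_K ⧸ U` abelian: the operator of `τ` commutes with `Fr_q⁻¹` (`commute_conjMap_of_commutator_le`),
hence with the Euler factor, a polynomial in `Fr_q⁻¹` (`eulerFactorOp = aeval (frobeniusInvOp …) (…)`).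
[cite: Rubin2000, Def. 2.1.1] [cite: SerreLocalFields1979, VII §5 Prop. 3] -/
theorem conjMap_eulerFactorOp_apply (U : Subgroup (absoluteGaloisGroup K)) [U.Normal]
    (hU : commutator (absoluteGaloisGroup K) ≤ U) (σ τ : absoluteGaloisGroup K) (y : H1 T U) :
    conjMap T.toTopRep U τ 1 (eulerFactorOp T U p σ y) =
      eulerFactorOp T U p σ (conjMap T.toTopRep U τ 1 y) := by
  have hcomm : Commute (frobeniusInvOp T U σ) (conjMap T.toTopRep U τ 1).hom.toLinearMap :=
    commute_conjMap_of_commutator_le T.toTopRep U hU σ⁻¹ τ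
  have h := (aeval_left_of_commute hcomm
    (rubinEulerFactor T.toRepresentation (cyclotomicCharacterToUnits K p A) σ)).eq
  have hy := LinearMap.congr_fun h y
  rw [Module.End.mul_apply, Module.End.mul_apply] at hy
  exact hy.symm

end EulerFactor

/-! ## §3 Euler systems are `Γ_K`-stable -/

section EulerSystemConj

variable {K : Type u} [Field K] [NumberField K] {ι : Type w} [Preorder ι] [OrderBot ι]
variable {A : Type v} [CommRing A] [TopologicalSpace A]
variable {M : Type u} [AddCommGroup M] [Module A M] [TopologicalSpace M] [IsTopologicalAddGroup M]
  [ContinuousSMul A M] [Module.Free A M] [Module.Finite A M]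
variable (L : EulerSystemLevels K ι) (T : GaloisRep K A M) (p : ℕ) [Fact p.Prime] [Algebra ℤ_[p] A]

omit [Module.Free A M] [Module.Finite A M] in
/-- Corestriction in the `K_∞`-direction is `Γ_K`-equivariant: `Cor (τ·y) = τ·(Cor y)`.
[cite: NeukirchSchmidtWingberg2008, I §5 Prop. 1.5.4] -/
theorem EulerSystemLevels.coresP_conjMap {i j : ι} (hij : i ≤ j) (r : Finset (HeightOneSpectrum (𝓞 K)))
    (τ : absoluteGaloisGroup K) (y : H1 T (L.level j r)) :
    L.coresP T hij r (conjMap T.toTopRep (L.level j r) τ 1 y) =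
      conjMap T.toTopRep (L.level i r) τ 1 (L.coresP T hij r y) := by
  letI : Fintype (L.level i r ⧸ (L.level j r).subgroupOf (L.level i r)) := Fintype.ofFinite _
  have h := coresLe_conjMap T.toTopRep (L.level_mono_left hij r) (L.isOpen_level j r) τ y
  unfold EulerSystemLevels.coresP
  convert h using 2

omit [Module.Free A M] [Module.Finite A M] in
/-- Corestriction in the tame direction is `Γ_K`-equivariant: `Cor (τ·y) = τ·(Cor y)`.
[cite: NeukirchSchmidtWingberg2008, I §5 Prop. 1.5.4] -/
theorem EulerSystemLevels.coresCons_conjMap (i : ι) (r : L.Ideals) (q : HeightOneSpectrum (𝓞 K))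
    (hq : q ∈ L.primes) (τ : absoluteGaloisGroup K) (y : H1 T (L.level i (r.cons q hq).1)) :
    L.coresCons T i r q hq (conjMap T.toTopRep (L.level i (r.cons q hq).1) τ 1 y) =
      conjMap T.toTopRep (L.level i r.1) τ 1 (L.coresCons T i r q hq y) := by
  letI : Fintype (L.level i r.1 ⧸ (L.level i (insert q r.1)).subgroupOf (L.level i r.1)) :=
    Fintype.ofFinite _
  exact coresLe_conjMap T.toTopRep (L.level_insert_le i r.1 q) (L.isOpen_level i (insert q r.1)) τ y

/-- **Euler systems are stable under `Γ_K`** (Rubin: the Euler systems of `T` form a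
`ℤ_p[[Γ_K]]`-module): if `c = (c_{i,r})` is an Euler system for `(T, L, p)`, so is `(τ · c_{i,r})`
for every `τ ∈ Γ_K`.  Corestriction commutes with `τ` (`coresP_conjMap`, `coresCons_conjMap`) and so
does the Euler factor `P(Fr_q⁻¹ | T*; Fr_q⁻¹)`, the levels being abelian over `K`
(`conjMap_eulerFactorOp_apply`).  With `IsEulerSystem.add/smul`: `ES(T)` is an `A[Γ_K]`-module.
[cite: Rubin2011, §4.1] [cite: Rubin2000, Def. 2.1.1 and Ch. IV §4] -/
theorem IsEulerSystem.conj {c : ∀ (i : ι) (r : L.Ideals), H1 T (L.level i r.1)}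
    (hc : IsEulerSystem L T p c) (τ : absoluteGaloisGroup K) :
    IsEulerSystem L T p (fun i r ↦ conjMap T.toTopRep (L.level i r.1) τ 1 (c i r)) where
  cores_p hij r := by
    simp only
    rw [L.coresP_conjMap T hij r.1 τ, hc.cores_p hij r]
  cores_cons_of_unramified i r q hq hqr hur := by
    simp only
    rw [L.coresCons_conjMap T i r q hq τ, hc.cores_cons_of_unramified i r q hq hqr hur]
  cores_cons i r q hq hqr hram σ hσ := by
    simp only
    rw [L.coresCons_conjMap T i r q hq τ, hc.cores_cons i r q hq hqr hram σ hσ,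
      conjMap_eulerFactorOp_apply T p (L.level i r.1) (L.commutator_le_level i r.1) σ τ (c i r)]

/-- The `A[Γ_K]`-module structure in the form used by refit arguments: for an Euler system `c`,
`τ ∈ Γ_K` and `a ∈ A`, the family `τ · c_{i,r} + a · c_{i,r}` is an Euler system.
[cite: Rubin2011, §4.1] -/
theorem IsEulerSystem.conj_add_smul {c c' : ∀ (i : ι) (r : L.Ideals), H1 T (L.level i r.1)}
    (hc : IsEulerSystem L T p c) (τ : absoluteGaloisGroup K) (a : A)
    (hc' : ∀ i r, c' i r = conjMap T.toTopRep (L.level i r.1) τ 1 (c i r) + a • c i r) :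
    IsEulerSystem L T p c' where
  cores_p hij r := by
    rw [hc', hc', map_add, map_smul, L.coresP_conjMap T hij r.1 τ, hc.cores_p hij r]
  cores_cons_of_unramified i r q hq hqr hur := by
    rw [hc', hc', map_add, map_smul, L.coresCons_conjMap T i r q hq τ,
      hc.cores_cons_of_unramified i r q hq hqr hur]
  cores_cons i r q hq hqr hram σ hσ := by
    rw [hc', hc', map_add, map_smul, L.coresCons_conjMap T i r q hq τ,
      hc.cores_cons i r q hq hqr hram σ hσ, map_add, map_smul,
      conjMap_eulerFactorOp_apply T p (L.level i r.1) (L.commutator_le_level i r.1) σ τ (c i r)]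

end EulerSystemConj

/-! ## §4 Unramified and locally trivial classes are `Γ_K`-stable -/

section LocalConditions

variable {K : Type u} [Field K]
variable {R : Type v} [Ring R] [TopologicalSpace R]
variable (X : TopRep.{u} R (absoluteGaloisGroup K)) (U : Subgroup (absoluteGaloisGroup K)) [U.Normal]

-- the pointwise `MulAction` of `Γ_K` on the ideals of `\bar ℤ_K` is slow to synthesise
set_option synthInstance.maxHeartbeats 160000 in
/-- `τ⁻¹ s τ ∈ I_{τ⁻¹ 𝔓}` for `s ∈ I_𝔓` (inertia groups of conjugate primes are conjugate).
[cite: SerreLocalFields1979, I §7 Prop. 20] -/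
theorem conj_mem_inertia_inv_smul (𝔓 : Ideal (absIntegers (𝓞 K) K)) (τ : absoluteGaloisGroup K)
    {s : absoluteGaloisGroup K} (hs : s ∈ 𝔓.inertia (absoluteGaloisGroup K)) :
    τ⁻¹ * s * τ ∈ (τ⁻¹ • 𝔓).inertia (absoluteGaloisGroup K) := by
  rw [AddSubgroup.mem_inertia] at hs ⊢
  intro x
  have h := hs (τ • x)
  rw [Submodule.mem_toAddSubgroup] at h ⊢
  rw [mul_smul, mul_smul, Ideal.mem_inv_pointwise_smul_iff, smul_sub, smul_inv_smul]
  exact h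

-- the pointwise `MulAction` of `Γ_K` on the ideals of `\bar ℤ_K` is slow to synthesise
set_option synthInstance.maxHeartbeats 160000 in
/-- `τ⁻¹ s τ ∈ D_{τ⁻¹ 𝔓}` for `s ∈ D_𝔓` (decomposition groups of conjugate primes are conjugate).
[cite: SerreLocalFields1979, I §7 Prop. 20] -/
theorem conj_mem_stabilizer_inv_smul (𝔓 : Ideal (absIntegers (𝓞 K) K)) (τ : absoluteGaloisGroup K)
    {s : absoluteGaloisGroup K} (hs : s ∈ MulAction.stabilizer (absoluteGaloisGroup K) 𝔓) :
    τ⁻¹ * s * τ ∈ MulAction.stabilizer (absoluteGaloisGroup K) (τ⁻¹ • 𝔓) := by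
  rw [MulAction.mem_stabilizer_iff] at hs ⊢
  rw [mul_smul, mul_smul, smul_inv_smul, hs]

-- the pointwise `MulAction` of `Γ_K` on the ideals of `\bar ℤ_K` is slow to synthesise
set_option synthInstance.maxHeartbeats 160000 in
/-- **"Unramified at `v`" is `Γ_K`-stable:** if `res_{U ∩ I_𝔓} y = 0` for every prime `𝔓 ∣ v` of
`\bar ℤ_K`, then the same holds for `τ · y` (`τ ∈ Γ_K`), because `τ⁻¹ (U ∩ I_𝔓) τ = U ∩ I_{τ⁻¹𝔓}` and
`τ⁻¹𝔓 ∣ v`. [cite: SerreLocalFields1979, VII §5 and I §7 Prop. 20] [cite: Rubin2000, Def. 2.1.1] -/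
theorem forall_resLe_inf_inertia_conjMap_eq_zero (v : HeightOneSpectrum (𝓞 K)) (τ : absoluteGaloisGroup K)
    {y : continuousCohomology 1 (subgroupRep X U)}
    (hy : ∀ 𝔓 ∈ v.primesAbove, resLe X
      (inf_le_left : U ⊓ 𝔓.inertia (absoluteGaloisGroup K) ≤ U) 1 y = 0) :
    ∀ 𝔓 ∈ v.primesAbove, resLe X
      (inf_le_left : U ⊓ 𝔓.inertia (absoluteGaloisGroup K) ≤ U) 1 (conjMap X U τ 1 y) = 0 := by
  intro 𝔓 h𝔓
  refine resLe_conjMap_eq_zero_of_forall_conj_mem X U τ inf_le_left inf_le_left ?_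
    (hy (τ⁻¹ • 𝔓) (smul_mem_primesAbove h𝔓 τ⁻¹))
  rintro s ⟨hsU, hsI⟩
  exact ⟨‹U.Normal›.conj_mem' s hsU τ, conj_mem_inertia_inv_smul 𝔓 τ hsI⟩

-- the pointwise `MulAction` of `Γ_K` on the ideals of `\bar ℤ_K` is slow to synthesise
set_option synthInstance.maxHeartbeats 160000 in
/-- **"Locally trivial at `v`" is `Γ_K`-stable:** if `res_{U ∩ D_𝔓} y = 0` for every prime `𝔓 ∣ v`
of `\bar ℤ_K` (`D_𝔓` the decomposition group = stabiliser), then the same holds for `τ · y`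
(`τ⁻¹ (U ∩ D_𝔓) τ = U ∩ D_{τ⁻¹𝔓}`). [cite: SerreLocalFields1979, VII §5 and I §7 Prop. 20] -/
theorem forall_resLe_inf_stabilizer_conjMap_eq_zero (v : HeightOneSpectrum (𝓞 K))
    (τ : absoluteGaloisGroup K) {y : continuousCohomology 1 (subgroupRep X U)}
    (hy : ∀ 𝔓 ∈ v.primesAbove, resLe X
      (inf_le_left : U ⊓ MulAction.stabilizer (absoluteGaloisGroup K) 𝔓 ≤ U) 1 y = 0) :
    ∀ 𝔓 ∈ v.primesAbove, resLe X
      (inf_le_left : U ⊓ MulAction.stabilizer (absoluteGaloisGroup K) 𝔓 ≤ U) 1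
        (conjMap X U τ 1 y) = 0 := by
  intro 𝔓 h𝔓
  refine resLe_conjMap_eq_zero_of_forall_conj_mem X U τ inf_le_left inf_le_left ?_
    (hy (τ⁻¹ • 𝔓) (smul_mem_primesAbove h𝔓 τ⁻¹))
  rintro s ⟨hsU, hsD⟩
  exact ⟨‹U.Normal›.conj_mem' s hsU τ, conj_mem_stabilizer_inv_smul 𝔓 τ hsD⟩

end LocalConditions

/-! ## §5 The group-ring action in finite-support form -/

section GroupRing

variable {K : Type u} [Field K] [NumberField K] {ι : Type w} [Preorder ι] [OrderBot ι]
variable {A : Type v} [CommRing A] [TopologicalSpace A]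
variable {M : Type u} [AddCommGroup M] [Module A M] [TopologicalSpace M] [IsTopologicalAddGroup M]
  [ContinuousSMul A M] [Module.Free A M] [Module.Finite A M]
variable (L : EulerSystemLevels K ι) (T : GaloisRep K A M) (p : ℕ) [Fact p.Prime] [Algebra ℤ_[p] A]

/-- **`ES(T)` is an `A[Γ_K]`-module** (finite-support form): for an Euler system `c`, scalars `a_j ∈ A`
and elements `τ_j ∈ Γ_K` (`j` in a finite set `s`), the family `Σ_{j ∈ s} a_j · (τ_j · c_{i,r})` — the action
of the group-ring element `Σ a_j τ_j ∈ A[Γ_K]`, level by level — is an Euler system (corestriction and the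
Euler factor are `A`-linear and commute with each `τ_j`). [cite: Rubin2011, §4.1] [cite: Rubin2000, Def. 2.1.1] -/
theorem IsEulerSystem.sum_smul_conj {c c' : ∀ (i : ι) (r : L.Ideals), H1 T (L.level i r.1)}
    (hc : IsEulerSystem L T p c) {ι' : Type*} (s : Finset ι') (a : ι' → A)
    (τ : ι' → absoluteGaloisGroup K)
    (hc' : ∀ i r, c' i r = ∑ j ∈ s, a j • conjMap T.toTopRep (L.level i r.1) (τ j) 1 (c i r)) :
    IsEulerSystem L T p c' where
  cores_p hij r := by
    rw [hc', hc', map_sum]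
    refine Finset.sum_congr rfl fun j _ ↦ ?_
    rw [map_smul, L.coresP_conjMap T hij r.1 (τ j), hc.cores_p hij r]
  cores_cons_of_unramified i r q hq hqr hur := by
    rw [hc', hc', map_sum]
    refine Finset.sum_congr rfl fun j _ ↦ ?_
    rw [map_smul, L.coresCons_conjMap T i r q hq (τ j), hc.cores_cons_of_unramified i r q hq hqr hur]
  cores_cons i r q hq hqr hram σ hσ := by
    rw [hc', hc', map_sum, map_sum]
    refine Finset.sum_congr rfl fun j _ ↦ ?_
    rw [map_smul, map_smul, L.coresCons_conjMap T i r q hq (τ j), hc.cores_cons i r q hq hqr hram σ hσ,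
      conjMap_eulerFactorOp_apply T p (L.level i r.1) (L.commutator_le_level i r.1) σ (τ j) (c i r)]

end GroupRing

end Literature.NumberTheory.GaloisRepresentations

end
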